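import Summits.CriticalPhenomena.PercolationContinuityZ3.Theorems.Transplant.FKConnectivityAllQForestAdjacentPathGadgetFacts
import Summits.CriticalPhenomena.PercolationContinuityZ3.Theorems.Transplant.FKConnectivityAllQForestSeparatorGlueRankOne
import HarnessLib

/-!
# The path gadget: structure of the doubly-`pq` residual colourings

builds on p205010 (kernel theorem, internal audit signed; external expert review pending).  No definitions, no named facts, no sorries;
standard axioms.

Separator `S = {o, p, q}` with the PATH gadget `{op, oq}` (both pairs free), sides `E₁`, `E₂` without pairs inside `S`
(memo bschramm/FROM-fk-1-g20-SEPARATOR-EXCHANGE.md §3).  By `…PathGadgetTransferA/B` and `…PathGadgetResidual` the node's inequality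
across such a separator lives on the RESIDUAL colourings that are DOUBLY-`pq` (`pq` joined on both sides in opposite classes).  This
file pins down their structure — the input of the product step (memo §6 item 2):
* `pathGadget_res_structure` — if `p ~ q` in `ω ∩ E₂` and in `(ω ∆ M') ∩ E₁`, then exactly one gadget pair lies in `ω`, the traces of
  `ω ∩ E₁` and `(ω ∆ M') ∩ E₂` on `S` are discrete, and the two joining classes join exactly `p, q` (neither `o, p` nor `o, q`):
  the colouring is of type `(d, pq | pq, d)`.  The mirror type `(pq, d | d, pq)` is the same statement for the partner `ω ∆ M'`
  (`pathGadget_res_structure'`).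
[cite: Grimmett2006, §1.5 (p. 13); §3.8 (pp. 61–62)]
-/

noncomputable section

namespace Summit.CriticalPhenomena.PercolationContinuityZ3.Theorems

namespace FK

open Set SimpleGraph Literature.Probability.LatticeModels Literature.Probability.Percolation
open scoped Classical

variable {V : Type*} [Fintype V]

section PathGadgetResClass

open scoped symmDiff

variable {E₁ E₂ : Set (Sym2 V)} {o p q : V}

/-- **Structure of a doubly-`pq` colouring, type `(d, pq | pq, d)`.**  Path gadget `{op, oq}` free (`op, oq ∈ M'`), no side pair inside
`S`; `ω`, `ω ∆ M'` forests; `p ~ q` in `ω ∩ E₂` and in `(ω ∆ M') ∩ E₁`.  Then: exactly one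
gadget pair is in `ω`; `ω ∩ E₁` and `(ω ∆ M') ∩ E₂` join no two points of `S`; `ω ∩ E₂` and `(ω ∆ M') ∩ E₁` join neither `o, p` nor
`o, q`. [cite: Grimmett2006, §1.5 (p. 13); §3.8 (pp. 61–62)] -/
theorem pathGadget_res_structure (hop : o ≠ p) (hoq : o ≠ q) (hpq : p ≠ q) (hd : Disjoint E₁ E₂)
    (hn₁ : ∀ x ∈ ({o, p, q} : Set V), ∀ x' ∈ ({o, p, q} : Set V), s(x, x') ∉ E₁)
    (hn₂ : ∀ x ∈ ({o, p, q} : Set V), ∀ x' ∈ ({o, p, q} : Set V), s(x, x') ∉ E₂)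
    {M' : BondConfig V} (hgp : s(o, p) ∈ M') (hgq : s(o, q) ∈ M') {ω : BondConfig V} (hF : IsForestCfg ω)
    (hFB : IsForestCfg (ω ∆ M'))
    (hA₂ : (openGraph (ω ∩ E₂)).Reachable p q) (hB₁ : (openGraph ((ω ∆ M') ∩ E₁)).Reachable p q) :
    (s(o, p) ∈ ω ↔ s(o, q) ∉ ω) ∧
      (∀ x ∈ ({o, p, q} : Set V), ∀ x' ∈ ({o, p, q} : Set V), (openGraph (ω ∩ E₁)).Reachable x x' → x = x') ∧
      (∀ x ∈ ({o, p, q} : Set V), ∀ x' ∈ ({o, p, q} : Set V), (openGraph ((ω ∆ M') ∩ E₂)).Reachable x x' → x = x') ∧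
      ¬ (openGraph (ω ∩ E₂)).Reachable o p ∧ ¬ (openGraph (ω ∩ E₂)).Reachable o q ∧
      ¬ (openGraph ((ω ∆ M') ∩ E₁)).Reachable o p ∧ ¬ (openGraph ((ω ∆ M') ∩ E₁)).Reachable o q := by
  have ho3 : o ∈ ({o, p, q} : Set V) := mem_insert _ _
  have hp3 : p ∈ ({o, p, q} : Set V) := mem_insert_of_mem _ (mem_insert _ _)
  have hq3 : q ∈ ({o, p, q} : Set V) := mem_insert_of_mem _ (mem_insert_of_mem _ rfl)
  have hopES : s(o, p) ∈ ({s(o, p), s(o, q)} : Set (Sym2 V)) := mem_insert _ _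
  have hoqES : s(o, q) ∈ ({s(o, p), s(o, q)} : Set (Sym2 V)) := mem_insert_of_mem _ rfl
  have hgpB : s(o, p) ∈ ω ∆ M' ↔ s(o, p) ∉ ω := mem_symmDiff_iff_of_mem hgp
  have hgqB : s(o, q) ∈ ω ∆ M' ↔ s(o, q) ∉ ω := mem_symmDiff_iff_of_mem hgq
  have hAdisj : Disjoint (ω ∩ E₁) (ω ∩ E₂) := Set.disjoint_of_subset inter_subset_right inter_subset_right hd
  have hBdisj : Disjoint ((ω ∆ M') ∩ E₁) ((ω ∆ M') ∩ E₂) := Set.disjoint_of_subset inter_subset_right inter_subset_right hd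
  -- no double joins with a gadget pair, and no second join of `p, q` inside the same class
  have ndj : ∀ {X : BondConfig V} {E : Set (Sym2 V)} {x x' : V}, IsForestCfg X → x ≠ x' → s(x, x') ∈ X →
      x ∈ ({o, p, q} : Set V) → x' ∈ ({o, p, q} : Set V) → (E = E₁ ∨ E = E₂) → ¬ (openGraph (X ∩ E)).Reachable x x' := by
    intro X E x x' hX hne hg hx hx' hEE
    refine not_reachable_inter_of_mem hX hne hg ?_
    rcases hEE with rfl | rfl
    · exact hn₁ x hx x' hx'
    · exact hn₂ x hx x' hx'
  have nA₁pq : ¬ (openGraph (ω ∩ E₁)).Reachable p q :=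
    not_reachable_of_disjoint_join hF inter_subset_left inter_subset_left hAdisj hpq hA₂
  have nB₂pq : ¬ (openGraph ((ω ∆ M') ∩ E₂)).Reachable p q :=
    not_reachable_of_disjoint_join hFB inter_subset_left inter_subset_left hBdisj.symm hpq hB₁
  -- `A₂` joins `p, q`: with `op ∈ A` it cannot join `o, p`, hence not `o, q`; with `oq ∈ A` symmetrically
  have nA₂ : ¬ (openGraph (ω ∩ E₂)).Reachable o p ∧ ¬ (openGraph (ω ∩ E₂)).Reachable o q := by
    by_cases hp : s(o, p) ∈ ω
    · have h1 : ¬ (openGraph (ω ∩ E₂)).Reachable o p := ndj hF hop hp ho3 hp3 (Or.inr rfl)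
      exact ⟨h1, fun h => h1 (h.trans hA₂.symm)⟩
    · by_cases hq : s(o, q) ∈ ω
      · have h2 : ¬ (openGraph (ω ∩ E₂)).Reachable o q := ndj hF hoq hq ho3 hq3 (Or.inr rfl)
        exact ⟨fun h => h2 (h.trans hA₂), h2⟩
      · -- both gadget pairs in `B`: `B₁` would be discrete (`sep_inter_of_two_pairs`), contradicting `p ~_{B₁} q`
        exact absurd (sep_inter_of_two_pairs hop hoq hpq hFB (hgpB.2 hp) (hgqB.2 hq) (hn₁ o ho3 p hp3) (hn₁ o ho3 q hq3) p hp3 q hq3 hB₁) hpq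
  have nB₁ : ¬ (openGraph ((ω ∆ M') ∩ E₁)).Reachable o p ∧ ¬ (openGraph ((ω ∆ M') ∩ E₁)).Reachable o q := by
    by_cases hp : s(o, p) ∈ ω ∆ M'
    · have h1 : ¬ (openGraph ((ω ∆ M') ∩ E₁)).Reachable o p := ndj hFB hop hp ho3 hp3 (Or.inl rfl)
      exact ⟨h1, fun h => h1 (h.trans hB₁.symm)⟩
    · by_cases hq : s(o, q) ∈ ω ∆ M'
      · have h2 : ¬ (openGraph ((ω ∆ M') ∩ E₁)).Reachable o q := ndj hFB hoq hq ho3 hq3 (Or.inl rfl)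
        exact ⟨fun h => h2 (h.trans hB₁), h2⟩
      · have hp' : s(o, p) ∈ ω := not_not.1 fun h => hp (hgpB.2 h)
        have hq' : s(o, q) ∈ ω := not_not.1 fun h => hq (hgqB.2 h)
        exact absurd (sep_inter_of_two_pairs hop hoq hpq hF hp' hq' (hn₂ o ho3 p hp3) (hn₂ o ho3 q hq3) p hp3 q hq3 hA₂) hpq
  -- exactly one gadget pair in `ω`
  have hgad : s(o, p) ∈ ω ↔ s(o, q) ∉ ω := by
    constructor
    · intro hp hq
      exact absurd (sep_inter_of_two_pairs hop hoq hpq hF hp hq (hn₂ o ho3 p hp3) (hn₂ o ho3 q hq3) p hp3 q hq3 hA₂) hpq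
    · intro hq
      by_contra hp
      exact absurd (sep_inter_of_two_pairs hop hoq hpq hFB (hgpB.2 hp) (hgqB.2 hq) (hn₁ o ho3 p hp3) (hn₁ o ho3 q hq3) p hp3 q hq3 hB₁)
        hpq
  -- the gadget pair of `ω` lies in `ω`, the other in `ω ∆ M'`: each class holds a gadget pair, so no two joins on opposite sides
  have gadA : ∃ g ∈ ({s(o, p), s(o, q)} : Set (Sym2 V)), g ∈ ω := by
    by_cases hp : s(o, p) ∈ ω
    · exact ⟨_, hopES, hp⟩
    · exact ⟨_, hoqES, not_not.1 fun h => hp (hgad.2 h)⟩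
  have gadB : ∃ g ∈ ({s(o, p), s(o, q)} : Set (Sym2 V)), g ∈ ω ∆ M' := by
    by_cases hp : s(o, p) ∈ ω
    · exact ⟨_, hoqES, hgqB.2 (hgad.1 hp)⟩
    · exact ⟨_, hopES, hgpB.2 hp⟩
  have hA₁d : ∀ x ∈ ({o, p, q} : Set V), ∀ x' ∈ ({o, p, q} : Set V), (openGraph (ω ∩ E₁)).Reachable x x' → x = x' := by
    intro x hx x' hx' hxx'
    by_contra hne
    obtain ⟨g, hg, hgω⟩ := gadA
    exact pathGadget_no_two_joins hop hoq hpq hd hn₁ hn₂ hF hx hx' hp3 hq3 hne hpq hxx' hA₂ g hg hgω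
  have hB₂d : ∀ x ∈ ({o, p, q} : Set V), ∀ x' ∈ ({o, p, q} : Set V), (openGraph ((ω ∆ M') ∩ E₂)).Reachable x x' → x = x' := by
    intro x hx x' hx' hxx'
    by_contra hne
    obtain ⟨g, hg, hgB⟩ := gadB
    exact pathGadget_no_two_joins hop hoq hpq hd hn₁ hn₂ hFB hp3 hq3 hx hx' hpq hne hB₁ hxx' g hg hgB
  exact ⟨hgad, hA₁d, hB₂d, nA₂.1, nA₂.2, nB₁.1, nB₁.2⟩

/-- **Structure of a doubly-`pq` colouring, mirror type `(pq, d | d, pq)`** — the previous statement for the partner `ω ∆ M'`.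
[cite: Grimmett2006, §1.5 (p. 13); §3.8 (pp. 61–62)] -/
theorem pathGadget_res_structure' (hop : o ≠ p) (hoq : o ≠ q) (hpq : p ≠ q) (hd : Disjoint E₁ E₂)
    (hn₁ : ∀ x ∈ ({o, p, q} : Set V), ∀ x' ∈ ({o, p, q} : Set V), s(x, x') ∉ E₁)
    (hn₂ : ∀ x ∈ ({o, p, q} : Set V), ∀ x' ∈ ({o, p, q} : Set V), s(x, x') ∉ E₂)
    {M' : BondConfig V} (hgp : s(o, p) ∈ M') (hgq : s(o, q) ∈ M') {ω : BondConfig V} (hF : IsForestCfg ω)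
    (hFB : IsForestCfg (ω ∆ M'))
    (hA₁ : (openGraph (ω ∩ E₁)).Reachable p q) (hB₂ : (openGraph ((ω ∆ M') ∩ E₂)).Reachable p q) :
    (s(o, p) ∈ ω ↔ s(o, q) ∉ ω) ∧
      (∀ x ∈ ({o, p, q} : Set V), ∀ x' ∈ ({o, p, q} : Set V), (openGraph ((ω ∆ M') ∩ E₁)).Reachable x x' → x = x') ∧
      (∀ x ∈ ({o, p, q} : Set V), ∀ x' ∈ ({o, p, q} : Set V), (openGraph (ω ∩ E₂)).Reachable x x' → x = x') ∧
      ¬ (openGraph ((ω ∆ M') ∩ E₂)).Reachable o p ∧ ¬ (openGraph ((ω ∆ M') ∩ E₂)).Reachable o q ∧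
      ¬ (openGraph (ω ∩ E₁)).Reachable o p ∧ ¬ (openGraph (ω ∩ E₁)).Reachable o q := by
  have hFB' : IsForestCfg ((ω ∆ M') ∆ M') := by rw [symmDiff_symmDiff_cancel_right]; exact hF
  obtain ⟨hgad, h1, h2, h3, h4, h5, h6⟩ := pathGadget_res_structure (E₁ := E₁) (E₂ := E₂) hop hoq hpq hd hn₁ hn₂ hgp hgq hFB
    hFB' hB₂ (by rw [symmDiff_symmDiff_cancel_right]; exact hA₁)
  rw [symmDiff_symmDiff_cancel_right] at h2 h5 h6
  refine ⟨?_, h1, h2, h3, h4, h5, h6⟩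
  rw [mem_symmDiff_iff_of_mem hgp, mem_symmDiff_iff_of_mem hgq, not_not] at hgad
  exact ⟨fun hp hq => (hgad.2 hq) hp, fun hq => not_not.1 fun hp => hq (hgad.1 hp)⟩

end PathGadgetResClass

end FK

end Summit.CriticalPhenomena.PercolationContinuityZ3.Theorems

end
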